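import Mathlib
import HarnessLib
import Summits.ResolutionOfSingularities.ResolutionOfSingularities.Theorems.WildQuotientsWildQuotientResolutionS1aQhCover

/-!
# S1a — R4a `tparab`: the tail `t = x₂ − x₁²`, the TAIL-NORM chart `N(t) = ∏ᵢ (x₂ − (x₁ + i·x₀)²)` (σ-fixed and KILLED), `hrad` and model values of the 3-cover

[OURS · L1 W4.5c · lead-1 g16; R4a brick 4b (after ✓`…S1aQhRoot`, ✓`…S1aQhCover`); plan-1 RULING R-F15n (2) `tparab_killsIn_two` (σ: x₁ ↦ x₁+x₀, u = x₂−x₁ ↦ u,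
x₃ ↦ x₃ + u − x₁²; ROOT (x₀:3, x₁:1, u:2; sh 2)); lead-1 g16 cover design: `(x₀^{n₀}, N(x₁)^{n₁}, N(t)^{n₂})` — the third chart is σ-STABLE (norm) and KILLED because
`t̂ ∣ N(t̂) ∈ 𝔞`, so the whole residual `F₁ = {X₀′ = 0, U′ = X₁′²}` sits in the `[N(x₁)]` chart (no `[u]`-chart needed)] — NOT statements of the manuscript; counted 0;
AI-level work, weaker than expert review. Crux stmt-ResolutionOfSingularities-17941 `CyclicQuotientFourfolds`, line `s1a-logminvertex` v13 (`stub_reachLowerInFX`).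

Here the recoordinated variable `x₂` IS the invariant `u`; weights `(3, 1, 2)`, shift `2`, tail `t = x₂ − x₁²`.
* `tparab_tail_mem` (`e⁻¹t ∈ 𝒥₂`), `tparab_subst_tail` (`subst t = x_none² · (x′₂ − x′₁²)`), `tparab_tail_eq` (`t̂ = u₂′ − u₁′²` in `R^w`);
* the tail norm `N(t)`: `tparab_normTail_mem/_fixed/_T`, `tparab_cover_two_mem`, `tparab_coverElement_two_eq` (`c₂ = (∏ᵢ (u₂′ − (u₁′ + i·u₀′s²)²))ⁿ`), ★ `tparab_tail_dvd_coverElement_two`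
  (`t̂ ∣ c₂`, so `c₂ ∈ 𝔞` by ✓`qh_mem_residual_of_dvd` and the chart of `c₂` is killed);
* `mem_radical_of_prod_add` (abstract), ★ `tparab_hrad` (`u₀′, u₁′, u₂′ ∈ √(c₀, c₁, c₂)`);
* model values through a pinned root model `Ψ`: `qh_model_coverElement_zero/one` (general weights), `tparab_model_coverElement_two`, and the facts the member step uses:
  `tparab_model_dvd_one` (`x′₁ ∣ Ψc₁`), `tparab_model_two_mem_span` (`Ψc₂ ∈ (x′₀, x′₂ − x′₁²)`), `tparab_model_eval_one` (`Ψc₁ ≠ 0` at the point `x′₁ = x′₂ = 1`).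
-/

set_option linter.dupNamespace false

noncomputable section

open Literature.AlgebraicGeometry.Resolution
open scoped LaurentPolynomial
open MvPolynomial
open Summit.ResolutionOfSingularities.ResolutionOfSingularities.Theorems.WildQuotientResolution.S1
open Summit.ResolutionOfSingularities.ResolutionOfSingularities.Theorems.WildQuotientResolution.S1.CoarseChart
open Summit.ResolutionOfSingularities.ResolutionOfSingularities.Theorems.WildQuotientResolution.S1.ReesBigrading
open Summit.ResolutionOfSingularities.ResolutionOfSingularities.Theorems.WildQuotientResolution.S1.BlowupCharts

/-! ## Model values of the `[x₀]` and `[N(x₁)]` cover elements (general weights) -/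

namespace Summit.ResolutionOfSingularities.ResolutionOfSingularities.Theorems.WildQuotientResolution.S1.KillCert.Qh

variable {k : Type} [Field k] {A : Type} [CommRing A] (w : Fin 3 → ℕ) (sh : ℕ) (e : A ≃+* MvPolynomial (Fin 4) k) (hw0 : w 0 = w 1 + sh) {p : ℕ}
  {m : ℕ} (mo : Fin m → ℕ) (𝒜 : (Π j : Fin m, ZMod (mo j)) → AddSubgroup A) [GradedRing 𝒜]
  {dbar : ℕ} (y : ↥(𝒜 0)) (hy : y ∈ (traceFiltration 𝒜 (e.symm ∘ ![X 0, X 1, X 2] : Fin 3 → A) w).ideal dbar)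
  (Ψ : ↥(cobordantAlgebra (e.symm ∘ ![X 0, X 1, X 2] : Fin 3 → A) w) ≃+* MvPolynomial (Option (Fin 4)) k)
  (hΨs : Ψ (cobordantAlgebra.s _ _) = X none)
  (hΨu : ∀ i : Fin 3, Ψ (cobordantAlgebra.u' (e.symm ∘ ![X 0, X 1, X 2] : Fin 3 → A) w i) = X (some (Fin.castSucc i)))

include hΨu in
/-- Model value of the `[x₀]` cover element: `Ψ c₀ = x′₀ⁿ`. -/
theorem qh_model_coverElement_zero (n : ℕ) (hdbar : dbar = w 0 * n) (hyval : (y : A) = e.symm (X 0) ^ n) :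
    Ψ (coverElement 𝒜 (e.symm ∘ ![X 0, X 1, X 2] : Fin 3 → A) w dbar y hy) = X (some 0) ^ n := by
  have hu0 := hΨu 0
  change Ψ _ = X (some 0) at hu0
  rw [qh_coverElement_zero_eq w e mo 𝒜 y hy n hdbar hyval, map_pow, hu0]

include hw0 hΨs hΨu in
/-- Model value of the `[N(x₁)]` cover element: `Ψ c₁ = (∏ᵢ (x′₁ + i·(x′₀·x_none^sh)))ⁿ`. -/
theorem qh_model_coverElement_one [NeZero p] (n : ℕ) (hdbar : dbar = p * w 1 * n)
    (hyval : (y : A) = (∏ i : ZMod p, (e.symm (X 1) + (i.val : A) * e.symm (X 0))) ^ n) :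
    Ψ (coverElement 𝒜 (e.symm ∘ ![X 0, X 1, X 2] : Fin 3 → A) w dbar y hy) =
      (∏ i : ZMod p, (X (some 1) + (i.val : MvPolynomial (Option (Fin 4)) k) * (X (some 0) * X none ^ sh))) ^ n := by
  have hu0 := hΨu 0
  have hu1 := hΨu 1
  change Ψ _ = X (some 0) at hu0
  change Ψ _ = X (some 1) at hu1
  rw [qh_coverElement_one_eq w sh e hw0 mo 𝒜 y hy n hdbar hyval, map_pow, map_prod]
  refine congrArg (· ^ n) (Finset.prod_congr rfl fun i _ => ?_)
  rw [map_add, map_mul, map_mul, map_pow, hu0, hu1, hΨs, map_natCast (algebraMap A ↥(cobordantAlgebra (e.symm ∘ ![X 0, X 1, X 2] : Fin 3 → A) w)), map_natCast Ψ]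

end Summit.ResolutionOfSingularities.ResolutionOfSingularities.Theorems.WildQuotientResolution.S1.KillCert.Qh

/-! ## The tparab tail and its norm chart -/

namespace Summit.ResolutionOfSingularities.ResolutionOfSingularities.Theorems.WildQuotientResolution.S1.KillCert.Tparab

/-- **Abstract radical step**: if all `aᵢ ∈ √I` and `∏ᵢ (U + aᵢ) ∈ √I` then `U ∈ √I` (read in the reduced ring `R/√I`). [folklore] -/
theorem mem_radical_of_prod_add {R : Type*} [CommRing R] {ι : Type*} [Fintype ι] (I : Ideal R) (U : R) (a : ι → R)
    (ha : ∀ i, a i ∈ I.radical) (hP : ∏ i, (U + a i) ∈ I.radical) : U ∈ I.radical := by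
  have hq : ∀ i, Ideal.Quotient.mk I.radical (a i) = 0 := fun i => Ideal.Quotient.eq_zero_iff_mem.mpr (ha i)
  have h := Ideal.Quotient.eq_zero_iff_mem.mpr hP
  rw [map_prod] at h
  simp_rw [map_add, hq, add_zero, Finset.prod_const, Finset.card_univ, ← map_pow] at h
  exact Ideal.mem_radical_of_pow_mem (Ideal.Quotient.eq_zero_iff_mem.mp h)

variable {k : Type} [Field k] {A : Type} [CommRing A]
  (σ : MvPolynomial (Fin 4) k ≃+* MvPolynomial (Fin 4) k)
  (h0 : σ (X 0) = X 0) (h1 : σ (X 1) = X 1 + X 0) (h2 : σ (X 2) = X 2)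
  (e : A ≃+* MvPolynomial (Fin 4) k) (τ : A ≃+* A) (hact : ∀ x : A, τ x = e.symm (σ (e x))) {p : ℕ}

/-- **The tparab tail lies in `𝒥₂`**: `e⁻¹(x₂ − x₁²) ∈ 𝒥₂(e⁻¹(x₀,x₁,x₂); (3,1,2))`. -/
theorem tparab_tail_mem : e.symm (X 2 - X 1 ^ 2) ∈ (weightedFiltration (e.symm ∘ ![X 0, X 1, X 2] : Fin 3 → A) ![3, 1, 2]).ideal 2 := by
  rw [map_sub, map_pow]
  refine sub_mem (mem_weightedFiltration_ideal (e.symm ∘ ![X 0, X 1, X 2] : Fin 3 → A) ![3, 1, 2] 2) ?_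
  exact GameFrame.GModel.pow_mem_weightedFiltration_ideal (e.symm ∘ ![X 0, X 1, X 2] : Fin 3 → A) ![3, 1, 2] 1 2

/-- The tparab tail in the free root model: `subst t = x_none² · (x′₂ − x′₁²)`. -/
theorem tparab_subst_tail : cobordantAlgebra.subst k (![3, 1, 2, 0] : Fin 4 → ℕ) (X 2 - X 1 ^ 2 : MvPolynomial (Fin 4) k) =
    X none ^ 2 * (X (some 2) - X (some 1) ^ 2) := by
  have h1 : (![3, 1, 2, 0] : Fin 4 → ℕ) 1 = 1 := rfl
  have h2 : (![3, 1, 2, 0] : Fin 4 → ℕ) 2 = 2 := rfl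
  simp only [cobordantAlgebra.subst, map_sub, map_pow, MvPolynomial.eval₂Hom_X', h1, h2]
  ring

/-- **The tail element in `R^w`**: `t̂ = e⁻¹t·T² = u₂′ − u₁′²`. -/
theorem tparab_tail_eq : (⟨_, C_mul_T_mem_cobordantAlgebra _ _ (tparab_tail_mem e)⟩ : ↥(cobordantAlgebra (e.symm ∘ ![X 0, X 1, X 2] : Fin 3 → A) ![3, 1, 2])) =
    cobordantAlgebra.u' (e.symm ∘ ![X 0, X 1, X 2] : Fin 3 → A) ![3, 1, 2] 2 - cobordantAlgebra.u' (e.symm ∘ ![X 0, X 1, X 2] : Fin 3 → A) ![3, 1, 2] 1 ^ 2 := by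
  refine Subtype.ext ?_
  rw [AddSubgroupClass.coe_sub, SubmonoidClass.coe_pow, cobordantAlgebra.coe_u', cobordantAlgebra.coe_u']
  change LaurentPolynomial.C (e.symm (X 2 - X 1 ^ 2)) * LaurentPolynomial.T ((2 : ℕ) : ℤ) =
    LaurentPolynomial.C (e.symm (X 2)) * LaurentPolynomial.T ((2 : ℕ) : ℤ) - (LaurentPolynomial.C (e.symm (X 1)) * LaurentPolynomial.T ((1 : ℕ) : ℤ)) ^ 2
  rw [map_sub, map_pow, map_sub, map_pow, mul_pow, LaurentPolynomial.T_pow]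
  push_cast
  ring

/-- The tail norm `N(t) = ∏ᵢ (e⁻¹x₂ − (e⁻¹x₁ + i·e⁻¹x₀)²)` lies in `𝒥_{2p}` (each factor in `𝒥₂`). -/
theorem tparab_normTail_mem [NeZero p] :
    (∏ i : ZMod p, (e.symm (X 2) - (e.symm (X 1) + (i.val : A) * e.symm (X 0)) ^ 2)) ∈ (weightedFiltration (e.symm ∘ ![X 0, X 1, X 2] : Fin 3 → A) ![3, 1, 2]).ideal (2 * p) := by
  have hX0 : e.symm (X 0) ∈ (weightedFiltration (e.symm ∘ ![X 0, X 1, X 2] : Fin 3 → A) ![3, 1, 2]).ideal 1 :=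
    (weightedFiltration _ _).antitone (show 1 ≤ 3 by norm_num) (mem_weightedFiltration_ideal (e.symm ∘ ![X 0, X 1, X 2] : Fin 3 → A) ![3, 1, 2] 0)
  have hlin : ∀ i : ZMod p, e.symm (X 1) + (i.val : A) * e.symm (X 0) ∈ (weightedFiltration (e.symm ∘ ![X 0, X 1, X 2] : Fin 3 → A) ![3, 1, 2]).ideal 1 :=
    fun i => add_mem (mem_weightedFiltration_ideal (e.symm ∘ ![X 0, X 1, X 2] : Fin 3 → A) ![3, 1, 2] 1) (Ideal.mul_mem_left _ _ hX0)
  have hfac : ∀ i : ZMod p, e.symm (X 2) - (e.symm (X 1) + (i.val : A) * e.symm (X 0)) ^ 2 ∈ (weightedFiltration (e.symm ∘ ![X 0, X 1, X 2] : Fin 3 → A) ![3, 1, 2]).ideal 2 := by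
    intro i
    refine sub_mem (mem_weightedFiltration_ideal (e.symm ∘ ![X 0, X 1, X 2] : Fin 3 → A) ![3, 1, 2] 2) ?_
    have h := (weightedFiltration (e.symm ∘ ![X 0, X 1, X 2] : Fin 3 → A) ![3, 1, 2]).mul_le 1 1 (Ideal.mul_mem_mul (hlin i) (hlin i))
    rwa [← pow_two] at h
  have := Ideal.prod_mem_prod (s := (Finset.univ : Finset (ZMod p))) (fun i _ => hfac i)
  rw [Finset.prod_const, Finset.card_univ, ZMod.card] at this
  exact Veronese.idealFiltration_pow_le (weightedFiltration (e.symm ∘ ![X 0, X 1, X 2] : Fin 3 → A) ![3, 1, 2]) 2 p this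

/-- **Cover element 2**: `N(t)ⁿ ∈ 𝒥_{dbar}` for `dbar = 2·p·n`. -/
theorem tparab_cover_two_mem [NeZero p] (n dbar : ℕ) (hdbar : dbar = 2 * p * n) :
    (∏ i : ZMod p, (e.symm (X 2) - (e.symm (X 1) + (i.val : A) * e.symm (X 0)) ^ 2)) ^ n ∈ (weightedFiltration (e.symm ∘ ![X 0, X 1, X 2] : Fin 3 → A) ![3, 1, 2]).ideal dbar := by
  have h := Ideal.pow_mem_pow (tparab_normTail_mem e (p := p)) n
  have hle := Veronese.idealFiltration_pow_le (weightedFiltration (e.symm ∘ ![X 0, X 1, X 2] : Fin 3 → A) ![3, 1, 2]) (2 * p) n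
  rw [← hdbar] at hle
  exact hle h

include hact h0 h1 h2 in
/-- The tail norm is `τ`-fixed (`τ` shifts the factor `i` to `i + 1`; characteristic `p ≠ 1`). -/
theorem tparab_normTail_fixed [NeZero p] [CharP A p] (hp1 : p ≠ 1) :
    τ (∏ i : ZMod p, (e.symm (X 2) - (e.symm (X 1) + (i.val : A) * e.symm (X 0)) ^ 2)) = ∏ i : ZMod p, (e.symm (X 2) - (e.symm (X 1) + (i.val : A) * e.symm (X 0)) ^ 2) := by
  rw [map_prod]
  have hτ : ∀ i : ZMod p, τ (e.symm (X 2) - (e.symm (X 1) + (i.val : A) * e.symm (X 0)) ^ 2) = e.symm (X 2) - (e.symm (X 1) + ((i + 1).val : A) * e.symm (X 0)) ^ 2 := by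
    intro i
    rw [map_sub, map_pow, map_add, map_mul, map_natCast, A1.act_symm σ e τ hact, A1.act_symm σ e τ hact, A1.act_symm σ e τ hact, h2, h1, h0, map_add]
    have hval : ((i + 1).val : A) = (i.val : A) + 1 := by
      rw [ZMod.val_add, ZMod.val_one'' hp1, ← CharP.cast_eq_mod A p (i.val + 1), Nat.cast_add, Nat.cast_one]
    rw [hval]; ring
  simp_rw [hτ]
  exact Fintype.prod_equiv (Equiv.addRight 1) _ _ fun i => rfl

include hact h0 h1 h2 in
/-- Cover element 2 is `τ`-fixed. -/
theorem tparab_cover_two_fixed [NeZero p] [CharP A p] (hp1 : p ≠ 1) (n : ℕ) :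
    τ ((∏ i : ZMod p, (e.symm (X 2) - (e.symm (X 1) + (i.val : A) * e.symm (X 0)) ^ 2)) ^ n) = (∏ i : ZMod p, (e.symm (X 2) - (e.symm (X 1) + (i.val : A) * e.symm (X 0)) ^ 2)) ^ n := by
  rw [map_pow, tparab_normTail_fixed σ h0 h1 h2 e τ hact hp1]

/-- `N(t)·T^{2p} = ∏ᵢ (u₂″ − (u₁″ + i·(u₀″ s²))²)` in `A[T;T⁻¹]`. -/
theorem tparab_normTail_T [NeZero p] : LaurentPolynomial.C (∏ i : ZMod p, (e.symm (X 2) - (e.symm (X 1) + (i.val : A) * e.symm (X 0)) ^ 2)) * LaurentPolynomial.T ((2 * p : ℕ) : ℤ) =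
    ∏ i : ZMod p, (LaurentPolynomial.C (e.symm (X 2)) * LaurentPolynomial.T ((2 : ℕ) : ℤ) - (LaurentPolynomial.C (e.symm (X 1)) * LaurentPolynomial.T ((1 : ℕ) : ℤ) +
      (i.val : A[T;T⁻¹]) * (LaurentPolynomial.C (e.symm (X 0)) * LaurentPolynomial.T ((3 : ℕ) : ℤ) * LaurentPolynomial.T (-((2 : ℕ) : ℤ)))) ^ 2) := by
  have hfac : ∀ i : ZMod p, LaurentPolynomial.C (e.symm (X 2)) * LaurentPolynomial.T ((2 : ℕ) : ℤ) - (LaurentPolynomial.C (e.symm (X 1)) * LaurentPolynomial.T ((1 : ℕ) : ℤ) +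
      (i.val : A[T;T⁻¹]) * (LaurentPolynomial.C (e.symm (X 0)) * LaurentPolynomial.T ((3 : ℕ) : ℤ) * LaurentPolynomial.T (-((2 : ℕ) : ℤ)))) ^ 2 =
      LaurentPolynomial.C (e.symm (X 2) - (e.symm (X 1) + (i.val : A) * e.symm (X 0)) ^ 2) * LaurentPolynomial.T ((2 : ℕ) : ℤ) := by
    intro i
    rw [mul_assoc, ← LaurentPolynomial.T_add, map_sub, map_pow, map_add, map_mul, map_natCast]
    have e1 : ((3 : ℕ) : ℤ) + -((2 : ℕ) : ℤ) = ((1 : ℕ) : ℤ) := by norm_num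
    rw [e1, sub_mul, add_pow_two, add_pow_two]
    have e2 : LaurentPolynomial.T ((2 : ℕ) : ℤ) = (LaurentPolynomial.T ((1 : ℕ) : ℤ) : A[T;T⁻¹]) * LaurentPolynomial.T ((1 : ℕ) : ℤ) := by
      rw [← LaurentPolynomial.T_add]; norm_num
    rw [e2]; ring
  simp_rw [hfac]
  rw [Finset.prod_mul_distrib, ← map_prod, Finset.prod_const, Finset.card_univ, ZMod.card, LaurentPolynomial.T_pow]
  have e3 : ((2 * p : ℕ) : ℤ) = (p : ℤ) * ((2 : ℕ) : ℤ) := by push_cast; ring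
  rw [e3]

variable {m : ℕ} (mo : Fin m → ℕ) (𝒜 : (Π j : Fin m, ZMod (mo j)) → AddSubgroup A) [GradedRing 𝒜]
  {dbar : ℕ} (y : ↥(𝒜 0)) (hy : y ∈ (traceFiltration 𝒜 (e.symm ∘ ![X 0, X 1, X 2] : Fin 3 → A) ![3, 1, 2]).ideal dbar)

/-- **Cover element 2 in `R^w`**: `c₂ = (∏ᵢ (u₂′ − (u₁′ + i·(u₀′ s²))²))ⁿ` when `(y : A) = N(t)ⁿ` and `dbar = 2·p·n`. -/
theorem tparab_coverElement_two_eq [NeZero p] (n : ℕ) (hdbar : dbar = 2 * p * n)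
    (hyval : (y : A) = (∏ i : ZMod p, (e.symm (X 2) - (e.symm (X 1) + (i.val : A) * e.symm (X 0)) ^ 2)) ^ n) :
    coverElement 𝒜 (e.symm ∘ ![X 0, X 1, X 2] : Fin 3 → A) ![3, 1, 2] dbar y hy =
      (∏ i : ZMod p, (cobordantAlgebra.u' (e.symm ∘ ![X 0, X 1, X 2] : Fin 3 → A) ![3, 1, 2] 2 - (cobordantAlgebra.u' (e.symm ∘ ![X 0, X 1, X 2] : Fin 3 → A) ![3, 1, 2] 1 +
        algebraMap A _ (i.val : A) * (cobordantAlgebra.u' (e.symm ∘ ![X 0, X 1, X 2] : Fin 3 → A) ![3, 1, 2] 0 *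
          cobordantAlgebra.s (e.symm ∘ ![X 0, X 1, X 2] : Fin 3 → A) ![3, 1, 2] ^ 2)) ^ 2)) ^ n := by
  refine Subtype.ext ?_
  rw [SubmonoidClass.coe_pow, SubmonoidClass.coe_finsetProd, coe_coverElement, hyval, hdbar]
  have hi : ∀ i : ZMod p, ((cobordantAlgebra.u' (e.symm ∘ ![X 0, X 1, X 2] : Fin 3 → A) ![3, 1, 2] 2 - (cobordantAlgebra.u' (e.symm ∘ ![X 0, X 1, X 2] : Fin 3 → A) ![3, 1, 2] 1 +
      algebraMap A _ (i.val : A) * (cobordantAlgebra.u' (e.symm ∘ ![X 0, X 1, X 2] : Fin 3 → A) ![3, 1, 2] 0 *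
        cobordantAlgebra.s (e.symm ∘ ![X 0, X 1, X 2] : Fin 3 → A) ![3, 1, 2] ^ 2)) ^ 2 : ↥(cobordantAlgebra (e.symm ∘ ![X 0, X 1, X 2] : Fin 3 → A) ![3, 1, 2])) : A[T;T⁻¹]) =
      LaurentPolynomial.C (e.symm (X 2)) * LaurentPolynomial.T ((2 : ℕ) : ℤ) - (LaurentPolynomial.C (e.symm (X 1)) * LaurentPolynomial.T ((1 : ℕ) : ℤ) +
        (i.val : A[T;T⁻¹]) * (LaurentPolynomial.C (e.symm (X 0)) * LaurentPolynomial.T ((3 : ℕ) : ℤ) * LaurentPolynomial.T (-((2 : ℕ) : ℤ)))) ^ 2 := by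
    intro i
    rw [AddSubgroupClass.coe_sub, SubmonoidClass.coe_pow, AddMemClass.coe_add, MulMemClass.coe_mul, MulMemClass.coe_mul, cobordantAlgebra.coe_u', cobordantAlgebra.coe_u',
      cobordantAlgebra.coe_u', cobordantAlgebra.coe_s_pow, cobordantAlgebra.coe_algebraMap, map_natCast]
    rfl
  simp_rw [hi]
  rw [← tparab_normTail_T e (p := p), mul_pow, ← map_pow, LaurentPolynomial.T_pow]
  congr 2
  push_cast
  ring

/-- ★ **The tail divides the tail-norm cover element**: `t̂ ∣ c₂` (the factor `i = 0`), for `n ≥ 1`. Hence `c₂ ∈ 𝔞` and the chart of `c₂` is KILLED. -/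
theorem tparab_tail_dvd_coverElement_two [NeZero p] (n : ℕ) (hn : 0 < n) (hdbar : dbar = 2 * p * n)
    (hyval : (y : A) = (∏ i : ZMod p, (e.symm (X 2) - (e.symm (X 1) + (i.val : A) * e.symm (X 0)) ^ 2)) ^ n) :
    (⟨_, C_mul_T_mem_cobordantAlgebra _ _ (tparab_tail_mem e)⟩ : ↥(cobordantAlgebra (e.symm ∘ ![X 0, X 1, X 2] : Fin 3 → A) ![3, 1, 2])) ∣
      coverElement 𝒜 (e.symm ∘ ![X 0, X 1, X 2] : Fin 3 → A) ![3, 1, 2] dbar y hy := by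
  rw [tparab_coverElement_two_eq e mo 𝒜 y hy n hdbar hyval, tparab_tail_eq e]
  refine dvd_trans ?_ (dvd_pow_self _ hn.ne')
  have h0 : cobordantAlgebra.u' (e.symm ∘ ![X 0, X 1, X 2] : Fin 3 → A) ![3, 1, 2] 2 - cobordantAlgebra.u' (e.symm ∘ ![X 0, X 1, X 2] : Fin 3 → A) ![3, 1, 2] 1 ^ 2 =
      cobordantAlgebra.u' (e.symm ∘ ![X 0, X 1, X 2] : Fin 3 → A) ![3, 1, 2] 2 - (cobordantAlgebra.u' (e.symm ∘ ![X 0, X 1, X 2] : Fin 3 → A) ![3, 1, 2] 1 +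
        algebraMap A _ ((0 : ZMod p).val : A) * (cobordantAlgebra.u' (e.symm ∘ ![X 0, X 1, X 2] : Fin 3 → A) ![3, 1, 2] 0 *
          cobordantAlgebra.s (e.symm ∘ ![X 0, X 1, X 2] : Fin 3 → A) ![3, 1, 2] ^ 2)) ^ 2 := by
    rw [ZMod.val_zero, Nat.cast_zero, map_zero, zero_mul, add_zero]
  rw [h0]
  exact Finset.dvd_prod_of_mem _ (Finset.mem_univ (0 : ZMod p))

/-- ★ **`hrad` for the tparab 3-cover** `c₀ = u₀′^{n₀}`, `c₁ = (∏ᵢ (u₁′ + i·u₀′s²))^{n₁}`, `c₂ = (∏ᵢ (u₂′ − (u₁′ + i·u₀′s²)²))^{n₂}` (`n₀, n₁ > 0`): the three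
irrelevant generators `u₀′, u₁′, u₂′` lie in `√(c₀, c₁, c₂)`. [OURS · L1 W4.5c · R4a] -/
theorem tparab_hrad [NeZero p] (c : Fin 3 → ↥(cobordantAlgebra (e.symm ∘ ![X 0, X 1, X 2] : Fin 3 → A) ![3, 1, 2])) {n₀ n₁ n₂ : ℕ} (hn₀ : 0 < n₀) (hn₁ : 0 < n₁)
    (hc₀ : c 0 = cobordantAlgebra.u' (e.symm ∘ ![X 0, X 1, X 2] : Fin 3 → A) ![3, 1, 2] 0 ^ n₀)
    (hc₁ : c 1 = (∏ i : ZMod p, (cobordantAlgebra.u' (e.symm ∘ ![X 0, X 1, X 2] : Fin 3 → A) ![3, 1, 2] 1 +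
        algebraMap A _ (i.val : A) * (cobordantAlgebra.u' (e.symm ∘ ![X 0, X 1, X 2] : Fin 3 → A) ![3, 1, 2] 0 *
          cobordantAlgebra.s (e.symm ∘ ![X 0, X 1, X 2] : Fin 3 → A) ![3, 1, 2] ^ 2))) ^ n₁)
    (hc₂ : c 2 = (∏ i : ZMod p, (cobordantAlgebra.u' (e.symm ∘ ![X 0, X 1, X 2] : Fin 3 → A) ![3, 1, 2] 2 - (cobordantAlgebra.u' (e.symm ∘ ![X 0, X 1, X 2] : Fin 3 → A) ![3, 1, 2] 1 +
        algebraMap A _ (i.val : A) * (cobordantAlgebra.u' (e.symm ∘ ![X 0, X 1, X 2] : Fin 3 → A) ![3, 1, 2] 0 *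
          cobordantAlgebra.s (e.symm ∘ ![X 0, X 1, X 2] : Fin 3 → A) ![3, 1, 2] ^ 2)) ^ 2)) ^ n₂) (l : Fin 3) :
    cobordantAlgebra.u' (e.symm ∘ ![X 0, X 1, X 2] : Fin 3 → A) ![3, 1, 2] l ∈ (Ideal.span (Set.range c)).radical := by
  obtain ⟨h0, h1⟩ := Qh.qh_rad_zero_one (![3, 1, 2] : Fin 3 → ℕ) 2 e (p := p) c 0 1 hn₀ hn₁ hc₀ hc₁
  have hB : cobordantAlgebra.u' (e.symm ∘ ![X 0, X 1, X 2] : Fin 3 → A) ![3, 1, 2] 0 * cobordantAlgebra.s (e.symm ∘ ![X 0, X 1, X 2] : Fin 3 → A) ![3, 1, 2] ^ 2 ∈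
      (Ideal.span (Set.range c)).radical := Ideal.mul_mem_right _ _ h0
  have h2 : cobordantAlgebra.u' (e.symm ∘ ![X 0, X 1, X 2] : Fin 3 → A) ![3, 1, 2] 2 ∈ (Ideal.span (Set.range c)).radical := by
    refine mem_radical_of_prod_add _ _ (fun i : ZMod p => -((cobordantAlgebra.u' (e.symm ∘ ![X 0, X 1, X 2] : Fin 3 → A) ![3, 1, 2] 1 +
        algebraMap A _ (i.val : A) * (cobordantAlgebra.u' (e.symm ∘ ![X 0, X 1, X 2] : Fin 3 → A) ![3, 1, 2] 0 *
          cobordantAlgebra.s (e.symm ∘ ![X 0, X 1, X 2] : Fin 3 → A) ![3, 1, 2] ^ 2)) ^ 2)) (fun i => ?_) ?_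
    · rw [neg_mem_iff, pow_two]
      exact Ideal.mul_mem_left _ _ (add_mem h1 (Ideal.mul_mem_left _ _ hB))
    · refine Ideal.mem_radical_of_pow_mem (m := n₂) ?_
      simp_rw [← sub_eq_add_neg]
      rw [← hc₂]; exact Ideal.le_radical (Ideal.subset_span ⟨2, rfl⟩)
  fin_cases l
  · exact h0
  · exact h1
  · exact h2

/-! ## Model values used by the member step -/

variable (Ψ : ↥(cobordantAlgebra (e.symm ∘ ![X 0, X 1, X 2] : Fin 3 → A) ![3, 1, 2]) ≃+* MvPolynomial (Option (Fin 4)) k)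
  (hΨs : Ψ (cobordantAlgebra.s _ _) = X none)
  (hΨu : ∀ i : Fin 3, Ψ (cobordantAlgebra.u' (e.symm ∘ ![X 0, X 1, X 2] : Fin 3 → A) ![3, 1, 2] i) = X (some (Fin.castSucc i)))

include hΨs hΨu in
/-- Model value of the tail-norm cover element: `Ψ c₂ = (∏ᵢ (x′₂ − (x′₁ + i·(x′₀·x_none²))²))ⁿ`. -/
theorem tparab_model_coverElement_two [NeZero p] (n : ℕ) (hdbar : dbar = 2 * p * n)
    (hyval : (y : A) = (∏ i : ZMod p, (e.symm (X 2) - (e.symm (X 1) + (i.val : A) * e.symm (X 0)) ^ 2)) ^ n) :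
    Ψ (coverElement 𝒜 (e.symm ∘ ![X 0, X 1, X 2] : Fin 3 → A) ![3, 1, 2] dbar y hy) =
      (∏ i : ZMod p, (X (some 2) - (X (some 1) + (i.val : MvPolynomial (Option (Fin 4)) k) * (X (some 0) * X none ^ 2)) ^ 2)) ^ n := by
  have hu0 := hΨu 0
  have hu1 := hΨu 1
  have hu2 := hΨu 2
  change Ψ _ = X (some 0) at hu0
  change Ψ _ = X (some 1) at hu1
  change Ψ _ = X (some 2) at hu2
  rw [tparab_coverElement_two_eq e mo 𝒜 y hy n hdbar hyval, map_pow, map_prod]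
  refine congrArg (· ^ n) (Finset.prod_congr rfl fun i _ => ?_)
  rw [map_sub, map_pow, map_add, map_mul, map_mul, map_pow, hu0, hu1, hu2, hΨs, map_natCast (algebraMap A ↥(cobordantAlgebra (e.symm ∘ ![X 0, X 1, X 2] : Fin 3 → A) ![3, 1, 2])),
    map_natCast Ψ]

/-- `x′₁` divides the model value `(∏ᵢ (x′₁ + i·(x′₀·x_none^sh)))ⁿ` of the `[N(x₁)]` cover element (`n ≥ 1`; the factor `i = 0`). -/
theorem tparab_model_dvd_one [NeZero p] (sh n : ℕ) (hn : 0 < n) :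
    (X (some 1) : MvPolynomial (Option (Fin 4)) k) ∣ (∏ i : ZMod p, (X (some 1) + (i.val : MvPolynomial (Option (Fin 4)) k) * (X (some 0) * X none ^ sh))) ^ n := by
  refine dvd_trans ?_ (dvd_pow_self _ hn.ne')
  have h0 : (X (some 1) : MvPolynomial (Option (Fin 4)) k) = X (some 1) + ((0 : ZMod p).val : MvPolynomial (Option (Fin 4)) k) * (X (some 0) * X none ^ sh) := by
    rw [ZMod.val_zero, Nat.cast_zero, zero_mul, add_zero]
  conv_lhs => rw [h0]
  exact Finset.dvd_prod_of_mem _ (Finset.mem_univ (0 : ZMod p))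

/-- The model value of the tail-norm cover element lies in the ideal `(x′₀, x′₂ − x′₁²)` of the graph member (`n ≥ 1`). -/
theorem tparab_model_two_mem_span [NeZero p] (n : ℕ) (hn : 0 < n) :
    (∏ i : ZMod p, (X (some 2) - (X (some 1) + (i.val : MvPolynomial (Option (Fin 4)) k) * (X (some 0) * X none ^ 2)) ^ 2)) ^ n ∈
      Ideal.span ({X (some 0), X (some 2) - X (some 1) ^ 2} : Set (MvPolynomial (Option (Fin 4)) k)) := by
  refine Ideal.pow_mem_of_mem _ ?_ _ hn
  have hfac : ∀ i : ZMod p, X (some 2) - (X (some 1) + (i.val : MvPolynomial (Option (Fin 4)) k) * (X (some 0) * X none ^ 2)) ^ 2 ∈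
      Ideal.span ({X (some 0), X (some 2) - X (some 1) ^ 2} : Set (MvPolynomial (Option (Fin 4)) k)) := by
    intro i
    have e1 : X (some 2) - (X (some 1) + (i.val : MvPolynomial (Option (Fin 4)) k) * (X (some 0) * X none ^ 2)) ^ 2 =
        (X (some 2) - X (some 1) ^ 2) + (-(2 * X (some 1) * (i.val : MvPolynomial (Option (Fin 4)) k) * X none ^ 2 +
          (i.val : MvPolynomial (Option (Fin 4)) k) ^ 2 * X (some 0) * X none ^ 4)) * X (some 0) := by ring
    rw [e1]
    exact add_mem (Ideal.subset_span (by simp)) (Ideal.mul_mem_left _ _ (Ideal.subset_span (by simp)))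
  have h := Ideal.prod_mem_prod (s := (Finset.univ : Finset (ZMod p))) (fun i _ => hfac i)
  rw [Finset.prod_const, Finset.card_univ, ZMod.card] at h
  exact Ideal.pow_le_self (NeZero.ne p) h

/-- At the point `x′₁ = x′₂ = 1` (others `0`) of `V(x′₀, x′₂ − x′₁²)` the model value of the `[N(x₁)]` cover element is `1 ≠ 0`. -/
theorem tparab_model_eval_one [NeZero p] (sh n : ℕ) :
    MvPolynomial.eval (fun o : Option (Fin 4) => o.elim (0 : k) ![0, 1, 1, 0])
      ((∏ i : ZMod p, (X (some 1) + (i.val : MvPolynomial (Option (Fin 4)) k) * (X (some 0) * X none ^ sh))) ^ n) ≠ 0 := by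
  rw [map_pow, map_prod]
  simp only [map_add, map_mul, map_pow, map_natCast, MvPolynomial.eval_X, Option.elim_some, Option.elim_none]
  have h1 : (![0, 1, 1, 0] : Fin 4 → k) 1 = 1 := rfl
  have h0 : (![0, 1, 1, 0] : Fin 4 → k) 0 = 0 := rfl
  rw [h1, h0]
  simp

end Summit.ResolutionOfSingularities.ResolutionOfSingularities.Theorems.WildQuotientResolution.S1.KillCert.Tparab

end
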